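import Literature.NumberTheory.Sieve.MaynardNFBilinear
import HarnessLib

/-!
# The Maynard–Tao sieve over `𝓞_K`: the smooth coefficients `y_𝔯 = F(log N𝔯ᵢ/log R)`

Topic `Literature/NumberTheory/Sieve`. A. Castillo, C. Hall, R. J. Lemke Oliver, P. Pollack,
L. Thompson, *Bounded gaps between primes in number fields and function fields*, Proc. AMS 143 (2015)
= arXiv:1403.5808, §2.2: the choice `y_{𝔯₁,…,𝔯_k} = F(log N𝔯₁/log R, …, log N𝔯_k/log R)` on good
tuples of the box (`F = 1_{R_k} G`), `0` otherwise (`smoothY`), and its elementary properties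
(support, bound, cut-off, value on good tuples). Everything PROVED.

## References

* Castillo–Hall–Lemke Oliver–Pollack–Thompson, arXiv:1403.5808, §2.2. [CastilloEtAl2015]
* J. Maynard, *Small gaps between primes*, Ann. of Math. 181 (2015), §6, (6.3). [MaynardAnnals2015]
-/

noncomputable section

open Finset NumberField IsDedekindDomain
open scoped NumberField Classical

namespace Literature.NumberTheory.Sieve.MaynardNF

open Literature.NumberTheory.LFunctions Literature.NumberTheory.LFunctions.NumberField

variable {K : Type*} [Field K] [NumberField K]
variable {k : ℕ}

variable (K) in
/-- The smooth coefficients `y_𝔯 = F(log N𝔯₁/log R, …, log N𝔯_k/log R)` for good tuples `𝔯` of the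
box `0 < N𝔯ᵢ ≤ R` (`μ(∏𝔯ᵢ)² = 1`, `(𝔯ᵢ, 𝔴) = 1`), `0` otherwise; `F` cut off to the simplex `R_k`.
With these, `lam R y` is the weight `λ_𝔡` of §2.2. [cite: CastilloEtAl2015, §2.2 (y_{𝔯₁,…,𝔯_k} := F(log|𝔯₁|/log R,…))] -/
def smoothY (k : ℕ) (F : (Fin k → ℝ) → ℝ) (R : ℝ) (𝔴 : Ideal (𝓞 K)) (𝔯 : Fin k → Ideal (𝓞 K)) : ℝ :=
  if 𝔯 ∈ box K k R ∧ IsGood 𝔴 𝔯 then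
    (maynardSimplex k).indicator F (fun i => Real.log (Ideal.absNorm (𝔯 i)) / Real.log R) else 0

/-- `smoothY` is supported on good tuples of the box. [folklore] -/
theorem supportedOn_smoothY (k : ℕ) (F : (Fin k → ℝ) → ℝ) (R : ℝ) (𝔴 : Ideal (𝓞 K)) :
    SupportedOn K k 𝔴 R (smoothY K k F R 𝔴) := by
  intro 𝔯 h
  by_contra hc
  exact h (by rw [smoothY, if_neg hc])


/-! ### The smooth coefficients -/

/-- `|y_𝔯| ≤ sup_{R_k} |G|`. [folklore] -/
theorem abs_smoothY_le {G : (Fin k → ℝ) → ℝ} {Gmax : ℝ} (hGmax : ∀ x ∈ maynardSimplex k, |G x| ≤ Gmax)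
    (hG0 : 0 ≤ Gmax) (R : ℝ) (𝔴 : Ideal (𝓞 K)) (𝔯 : Fin k → Ideal (𝓞 K)) :
    |smoothY K k G R 𝔴 𝔯| ≤ Gmax := by
  unfold smoothY
  split_ifs with h
  · by_cases hx : (fun i => Real.log (Ideal.absNorm (𝔯 i)) / Real.log R) ∈ maynardSimplex k
    · rw [Set.indicator_of_mem hx]; exact hGmax _ hx
    · rw [Set.indicator_of_notMem hx, abs_zero]; exact hG0
  · rw [abs_zero]; exact hG0

/-- `y_𝔯 ≠ 0 ⇒ ∏ N𝔯ᵢ ≤ R` (the cut-off to the simplex; `R > 1`). [cite: CastilloEtAl2015, §2.2 (λ supported on ∏|𝔡ᵢ| < R)] -/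
theorem prod_absNorm_le_of_smoothY_ne_zero {G : (Fin k → ℝ) → ℝ} {R : ℝ} (hR : 1 < R)
    {𝔴 : Ideal (𝓞 K)} {𝔯 : Fin k → Ideal (𝓞 K)} (h : smoothY K k G R 𝔴 𝔯 ≠ 0) :
    ∏ i, (Ideal.absNorm (𝔯 i) : ℝ) ≤ R := by
  unfold smoothY at h
  split_ifs at h with hc
  · have hx : (fun i => Real.log (Ideal.absNorm (𝔯 i)) / Real.log R) ∈ maynardSimplex k := by
      by_contra hx
      exact h (Set.indicator_of_notMem hx _)
    obtain ⟨-, hsum⟩ := hx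
    have hlogR : 0 < Real.log R := Real.log_pos hR
    have hsum' : ∑ i, Real.log (Ideal.absNorm (𝔯 i) : ℝ) ≤ Real.log R := by
      rw [← Finset.sum_div, div_le_one hlogR] at hsum
      exact hsum
    have hpos : ∀ i, (0 : ℝ) < Ideal.absNorm (𝔯 i) := fun i => by
      exact_mod_cast Nat.pos_of_ne_zero (by
        rw [Ne, Ideal.absNorm_eq_zero_iff]; exact (mem_box_iff.1 hc.1 i).1)
    have hprod : 0 < ∏ i, (Ideal.absNorm (𝔯 i) : ℝ) := Finset.prod_pos fun i _ => hpos i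
    rw [← Real.log_le_log_iff hprod (by linarith), Real.log_prod]
    · exact hsum'
    · exact fun i _ => (hpos i).ne'
  · exact absurd rfl h

/-- On good tuples of the box, `y_𝔯 = F(x_𝔯)`. [folklore] -/
theorem smoothY_of_mem_boxG {G : (Fin k → ℝ) → ℝ} {R : ℝ} {𝔴 : Ideal (𝓞 K)} {𝔯 : Fin k → Ideal (𝓞 K)}
    (h : 𝔯 ∈ boxG K k 𝔴 R) :
    smoothY K k G R 𝔴 𝔯 =
      (maynardSimplex k).indicator G (fun i => Real.log (Ideal.absNorm (𝔯 i)) / Real.log R) := by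
  rw [smoothY, if_pos (mem_boxG.1 h)]


end Literature.NumberTheory.Sieve.MaynardNF
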